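import Summits.QuantumFields.YangMills.Theorems.FlatTubeReductionDressingClamp
import Summits.QuantumFields.YangMills.Theorems.FlatTubeReductionExactDressingTwist
import Summits.QuantumFields.YangMills.Theorems.FlatTubeReductionEigenMomentsBootstrap
import Summits.QuantumFields.YangMills.Theorems.LuscherReductionTwistedTraceScalingBTCoreWeight
import HarnessLib

/-!
# The DRESSED WEIGHT of the rate twin: `W̃ = clampW κ f̂ (min(d_tor, ½))` — the five `W`-fields of `RateTube.AnalyticRatePotInput` for ANY physical near-`1` family `f̂`,
# and the exact diagonal ratio `f(u) = fpBOKernel β Ω W u u / K₁^{(L³β)}(u,u)` is such a family (measurable in `u`, `≥ 0`, colour and twist invariant)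
# (route `FlatTubeReduction`, crux K1 `NearFlatRatioLaw` stmt-QuantumFields-24720; seat `ym-line-ftr-p1` g14; rate twin «ratepack-v3 / frozen fibres»; R2b1 RECORD rung — no summit
# statement is proved here)

WHY (memo `Cruxes/NearFlatRatioLaw/Lines/ratepack-v3-frozen-g12.md` §6.1 (F8c)).  The hand-off object `RateTube.AnalyticRatePotInput` asks for a dressed one-site weight `W β`
with `hWphys` (physical: measurable, bounded, gauge AND twist invariant), `hW0` (`0 ≤ W`), `hWbU` (`|W| ≤ C_W`), `hκW`, and the POINTWISE two-sided field
`hWsq : orbitDist u < δ₁ β → |W β u² − 1| ≤ κ_W·orbitDist u²` — for EVERY `β`.  The κ_W machine (F8a `fpBOKernel_diag_two_sided_on_core` + F8b numerology) delivers the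
normalised exact diagonal ratio `f̂_β(u) = f_β(u)/f_β(1)` only eventually and only as `|f̂ − 1| ≤ κ·orbitDist² + ε_W(β)`.  The CLAMP at the capped toron distance
`d = min(d_tor, ½)` (`= orbitDist` on `{orbitDist < ½}` at one site; gauge and twist invariant; `≤ ½`) turns any such family into a weight with ALL five fields, uniformly in `β`
and with `C_W = √(1 + κ/4)` — no bound on `f̂` is needed — and moves `f̂` by at most `ε_W` in the square on the window (the slack is paid inside the (B-T) brick `hT`).
* §1 `clampW_sq_le` (`W̃² ≤ 1 + κd²`), ★ `isPhys_clampW_capTor`, `abs_clampW_capTor_le`, ★ `abs_clampW_capTor_sq_sub_one_le` (`|W̃² − 1| ≤ κ·orbitDist²`, all `u`),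
  ★ `abs_clampW_capTor_sq_sub_le` (`|W̃² − f̂| ≤ ε` on `{orbitDist < ½}`);
* §2 ★ `measurable_fpBOKernel_diag` (`u ↦ fpBOKernel β Ω W u u` is measurable — Fubini measurability of the product integrand, joint in `(u,p)`), `measurable_diagRatio`,
  `diagRatio_nonneg`, ★★ `isPhys_dressedDiagRatio` (the clamp of `f̂` IS physical for colour-blind `Ω` and the FP weight);
* §3 ★★ `dressedWeight_fields` — the β-family: from `∀ᶠ β, ∀ u, orbitDist u < δ₁ β → |f̂_β u − 1| ≤ κ₀·orbitDist u² + ε_W β` (+ `δ₁ ≤ ½`, `0 ≤ ε_W`, `0 ≤ f̂` eventually) the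
  fields `hWphys, hW0, hWbU, hWsq` for all `β` and `|W̃_β² − f̂_β| ≤ ε_W β` on the window eventually.
HONEST FRAMING: real analysis + symmetry bookkeeping; the INPUT near-`1` estimate is F8a/F8b modulo the profile interface; femto rung R2b1 (RECORD label); not infinite volume, not a
gap, not Clay.  No defs, no named facts, no `sorry`.
-/

set_option autoImplicit false

noncomputable section

open MeasureTheory Filter Topology Real
open scoped BigOperators
open Literature.MathematicalPhysics.QuantumFieldTheory
open Literature.MathematicalPhysics.QuantumLattice

namespace Summit.QuantumFields.YangMills.Theorems.FemtoTransferGap.RateTube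

open Summit.QuantumFields.YangMills.Theorems.FemtoTransferGap
open Summit.QuantumFields.YangMills.Theorems.FemtoTransferGap.TwoLattice
open Summit.QuantumFields.YangMills.Theorems.FemtoTransferGap.TwoLattice.ConstTube
open Summit.QuantumFields.YangMills.Theorems.FemtoTransferGap.TwoLattice.Avg
open Summit.QuantumFields.YangMills.Theorems.FemtoTransferGap.TwoLattice.Stiff (LinkSpace)

/-! ## §1 The clamp at the capped toron distance -/

section Clamp

variable {α : Type*}

/-- `clampW κ f d a² ≤ 1 + κ·d(a)²` for `κ ≥ 0` (no bound on `f` needed). [folklore] -/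
theorem clampW_sq_le {κ : ℝ} (hκ : 0 ≤ κ) (f d : α → ℝ) (a : α) : clampW κ f d a ^ 2 ≤ 1 + κ * d a ^ 2 := by
  rw [clampW_sq]
  have hk : 0 ≤ κ * d a ^ 2 := mul_nonneg hκ (sq_nonneg _)
  refine max_le (by linarith) (max_le (by linarith) (min_le_left _ _))

/-- `clampW κ f d a ≤ √(1 + κ·D²)` whenever `|d a| ≤ D` (`κ ≥ 0`). [folklore] -/
theorem clampW_le_of_abs_le {κ : ℝ} (hκ : 0 ≤ κ) (f d : α → ℝ) {D : ℝ} {a : α} (hd : |d a| ≤ D) : clampW κ f d a ≤ Real.sqrt (1 + κ * D ^ 2) := by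
  have h1 : clampW κ f d a ^ 2 ≤ 1 + κ * D ^ 2 := by
    have hdD : d a ^ 2 ≤ D ^ 2 := by
      have := sq_abs (d a); rw [← this]; exact pow_le_pow_left₀ (abs_nonneg _) hd 2
    exact (clampW_sq_le hκ f d a).trans (by nlinarith)
  have h0 := clampW_nonneg κ f d a
  calc clampW κ f d a = Real.sqrt (clampW κ f d a ^ 2) := (Real.sqrt_sq h0).symm
    _ ≤ Real.sqrt (1 + κ * D ^ 2) := Real.sqrt_le_sqrt h1

end Clamp

variable {L : ℕ} [NeZero L]

/-- ★ **The clamp of a physical family at the capped toron distance is PHYSICAL**: measurable, bounded by `√(1 + κ/4)`, gauge and twist invariant. [cite: tHooft1979] -/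
theorem isPhys_clampW_capTor {κ : ℝ} (hκ : 0 ≤ κ) {f : GaugeConfig 3 L SU2 → ℝ} (hfm : Measurable f)
    (hfg : ∀ (g : Site 3 L → SU2) (U : GaugeConfig 3 L SU2), f (gaugeTransform g U) = f U)
    (hft : ∀ (k : Fin 3), ∀ z ∈ Subgroup.center SU2, ∀ U : GaugeConfig 3 L SU2, f (twist k z U) = f U) :
    IsPhys (clampW κ f (fun U : GaugeConfig 3 L SU2 => min (torDist U) (1 / 2))) where
  measurable := measurable_clampW κ hfm measurable_capTor
  bounded := ⟨Real.sqrt (1 + κ * (1 / 2) ^ 2), fun U => by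
    rw [abs_of_nonneg (clampW_nonneg _ _ _ _)]
    refine clampW_le_of_abs_le hκ f _ ?_
    rw [abs_of_nonneg (le_min (torDist_nonneg U) (by norm_num))]
    exact min_le_right _ _⟩
  gaugeInv := fun g U => clampW_comp κ (T := gaugeTransform g) (hfg g) (fun V => by simp only [torDist_gaugeTransform]) U
  zeroFlux := fun k z hz U => clampW_comp κ (T := twist k z) (hft k z hz) (fun V => by simp only [torDist_twist k hz]) U

/-- `|W̃| ≤ √(1 + κ/4)`. [folklore] -/
theorem abs_clampW_capTor_le {κ : ℝ} (hκ : 0 ≤ κ) (f : GaugeConfig 3 L SU2 → ℝ) (U : GaugeConfig 3 L SU2) :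
    |clampW κ f (fun U : GaugeConfig 3 L SU2 => min (torDist U) (1 / 2)) U| ≤ Real.sqrt (1 + κ / 4) := by
  rw [abs_of_nonneg (clampW_nonneg _ _ _ _)]
  have h := clampW_le_of_abs_le hκ f (fun U : GaugeConfig 3 L SU2 => min (torDist U) (1 / 2)) (D := 1 / 2) (a := U)
    (by rw [abs_of_nonneg (le_min (torDist_nonneg U) (by norm_num))]; exact min_le_right _ _)
  have e : (1 : ℝ) + κ * (1 / 2) ^ 2 = 1 + κ / 4 := by ring
  rwa [e] at h

/-- ★ **`hWsq` for every configuration**: `|W̃² − 1| ≤ κ·orbitDist²` (the capped toron distance is `≤ orbitDist`). [folklore] -/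
theorem abs_clampW_capTor_sq_sub_one_le {κ : ℝ} (hκ : 0 ≤ κ) (f : GaugeConfig 3 L SU2 → ℝ) (U : GaugeConfig 3 L SU2) :
    |clampW κ f (fun U : GaugeConfig 3 L SU2 => min (torDist U) (1 / 2)) U ^ 2 - 1| ≤ κ * orbitDist U ^ 2 := by
  have h := abs_clampW_sq_sub_one_le hκ f (fun U : GaugeConfig 3 L SU2 => min (torDist U) (1 / 2)) U
  have hd0 : 0 ≤ min (torDist U) (1 / 2) := le_min (torDist_nonneg U) (by norm_num)
  have hd : min (torDist U) (1 / 2) ≤ orbitDist U := (min_le_left _ _).trans (torDist_le_orbitDist U)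
  have h2 : κ * min (torDist U) (1 / 2) ^ 2 ≤ κ * orbitDist U ^ 2 := mul_le_mul_of_nonneg_left (pow_le_pow_left₀ hd0 hd 2) hκ
  exact h.trans h2

/-- ★ **The clamp moves the family by at most the slack on the one-site window** `{orbitDist < ½}`: if `0 ≤ f u`, `|f u − 1| ≤ κ₀·orbitDist u² + ε` with `κ₀ ≤ κ`, `0 ≤ ε`,
then `|W̃ u² − f u| ≤ ε`. [folklore] -/
theorem abs_clampW_capTor_sq_sub_le {κ₀ κ ε : ℝ} (hκκ : κ₀ ≤ κ) (hκ : 0 ≤ κ) (hε : 0 ≤ ε) {f : GaugeConfig 3 1 SU2 → ℝ} {u : GaugeConfig 3 1 SU2}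
    (hu : orbitDist u < 1 / 2) (hf0 : 0 ≤ f u) (hf : |f u - 1| ≤ κ₀ * orbitDist u ^ 2 + ε) :
    |clampW κ f (fun U : GaugeConfig 3 1 SU2 => min (torDist U) (1 / 2)) u ^ 2 - f u| ≤ ε := by
  refine abs_clampW_sq_sub_le hκκ hκ hε hf0 ?_
  show |f u - 1| ≤ κ₀ * min (torDist u) (1 / 2) ^ 2 + ε
  rw [capTor_eq_orbitDist_of_lt hu]
  exact hf

/-! ## §2 The exact diagonal ratio is a physical near-`1` family candidate -/

/-- ★ **`u ↦ fpBOKernel β Ω W u u` is measurable** (bounded measurable `Ω`, `W`): the product integrand is jointly measurable in `(u, p)`, so its `p`-integral is measurable in `u`.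
[folklore] -/
theorem measurable_fpBOKernel_diag (β : ℝ) {Ω : LinkSpace L → ℝ} (hΩm : Measurable Ω) {CΩ : ℝ} (hCΩ : ∀ x, |Ω x| ≤ CΩ) {W : (Site 3 L → SU2) → ℝ}
    (hW : Measurable W) {CW : ℝ} (hCW : ∀ g, |W g| ≤ CW) : Measurable fun u : GaugeConfig 3 1 SU2 => fpBOKernel L β Ω W u u := by
  haveI := isFiniteMeasure_orthoTransverse L
  haveI : SecondCountableTopology SU2 := secondCountableTopology_su2
  have e : (fun u : GaugeConfig 3 1 SU2 => fpBOKernel L β Ω W u u) =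
      fun u => ∫ p, fpTriple L β Ω W u u p ∂((orthoTransverse L).prod ((orthoTransverse L).prod (gaugeMeasure L))) := by
    funext u; exact fpBOKernel_eq_integral_prod β hΩm hCΩ hW hCW u u
  rw [e]
  -- joint measurability of `(u, p) ↦ fpTriple β Ω W u u p`
  have hK : Measurable fun q : GaugeConfig 3 L SU2 × GaugeConfig 3 L SU2 => transferKernel su2Rep β q.1 q.2 :=
    (continuous_transferKernel su2Rep continuous_su2Rep β).measurable
  have hle := measurable_linkEmbed L
  have h1 : Measurable fun q : GaugeConfig 3 1 SU2 × ((Edge 3 L → Fin 3 → ℝ) × ((Edge 3 L → Fin 3 → ℝ) × (Site 3 L → SU2))) => orthoTube L q.1 q.2.1 := by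
    have h := (measurable_orthoTube L).comp (measurable_fst.prodMk (measurable_fst.comp measurable_snd) :
      Measurable fun q : GaugeConfig 3 1 SU2 × ((Edge 3 L → Fin 3 → ℝ) × ((Edge 3 L → Fin 3 → ℝ) × (Site 3 L → SU2))) => (q.1, q.2.1))
    simpa only [Function.comp_def] using h
  have h2 : Measurable fun q : GaugeConfig 3 1 SU2 × ((Edge 3 L → Fin 3 → ℝ) × ((Edge 3 L → Fin 3 → ℝ) × (Site 3 L → SU2))) =>
      gaugeTransform q.2.2.2 (orthoTube L q.1 q.2.2.1) := by
    have ha : Measurable fun q : GaugeConfig 3 1 SU2 × ((Edge 3 L → Fin 3 → ℝ) × ((Edge 3 L → Fin 3 → ℝ) × (Site 3 L → SU2))) => orthoTube L q.1 q.2.2.1 := by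
      have h := (measurable_orthoTube L).comp (measurable_fst.prodMk (measurable_fst.comp (measurable_snd.comp measurable_snd)) :
        Measurable fun q : GaugeConfig 3 1 SU2 × ((Edge 3 L → Fin 3 → ℝ) × ((Edge 3 L → Fin 3 → ℝ) × (Site 3 L → SU2))) => (q.1, q.2.2.1))
      simpa only [Function.comp_def] using h
    have h := (measurable_gaugeAction (L := L)).comp (ha.prodMk (measurable_snd.comp (measurable_snd.comp measurable_snd)))
    simpa only [Function.comp_def] using h
  have hK' : Measurable fun q : GaugeConfig 3 1 SU2 × ((Edge 3 L → Fin 3 → ℝ) × ((Edge 3 L → Fin 3 → ℝ) × (Site 3 L → SU2))) =>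
      transferKernel su2Rep β (orthoTube L q.1 q.2.1) (gaugeTransform q.2.2.2 (orthoTube L q.1 q.2.2.1)) := by
    have h := hK.comp (h1.prodMk h2); simpa only [Function.comp_def] using h
  have hF : Measurable fun q : GaugeConfig 3 1 SU2 × ((Edge 3 L → Fin 3 → ℝ) × ((Edge 3 L → Fin 3 → ℝ) × (Site 3 L → SU2))) => fpTriple L β Ω W q.1 q.1 q.2 := by
    unfold fpTriple
    exact (hΩm.comp (hle.comp (measurable_fst.comp measurable_snd))).mul
      (((hW.comp (measurable_snd.comp (measurable_snd.comp measurable_snd))).mul hK').mul (hΩm.comp (hle.comp (measurable_fst.comp (measurable_snd.comp measurable_snd)))))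
  exact (hF.stronglyMeasurable.integral_prod_right' (ν := (orthoTransverse L).prod ((orthoTransverse L).prod (gaugeMeasure L)))).measurable

/-- `u ↦ f(u) = fpBOKernel β Ω W u u / K₁^{(L³β)}(u,u)` is measurable. [folklore] -/
theorem measurable_diagRatio (β : ℝ) {Ω : LinkSpace L → ℝ} (hΩm : Measurable Ω) {CΩ : ℝ} (hCΩ : ∀ x, |Ω x| ≤ CΩ) {W : (Site 3 L → SU2) → ℝ}
    (hW : Measurable W) {CW : ℝ} (hCW : ∀ g, |W g| ≤ CW) :
    Measurable fun u : GaugeConfig 3 1 SU2 => fpBOKernel L β Ω W u u / transferKernel su2Rep ((L : ℝ) ^ 3 * β) u u := by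
  have hK : Measurable fun u : GaugeConfig 3 1 SU2 => transferKernel su2Rep ((L : ℝ) ^ 3 * β) u u :=
    ((continuous_transferKernel su2Rep continuous_su2Rep ((L : ℝ) ^ 3 * β)).comp (continuous_id.prodMk continuous_id)).measurable
  exact (measurable_fpBOKernel_diag β hΩm hCΩ hW hCW).div hK

/-- `0 ≤ f(u)` for a nonnegative profile and weight. [folklore] -/
theorem diagRatio_nonneg (β : ℝ) {Ω : LinkSpace L → ℝ} (hΩm : Measurable Ω) {CΩ : ℝ} (hCΩ : ∀ x, |Ω x| ≤ CΩ) (hΩ0 : ∀ x, 0 ≤ Ω x) {W : (Site 3 L → SU2) → ℝ}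
    (hW : Measurable W) {CW : ℝ} (hCW : ∀ g, |W g| ≤ CW) (hW0 : ∀ g, 0 ≤ W g) (u : GaugeConfig 3 1 SU2) :
    0 ≤ fpBOKernel L β Ω W u u / transferKernel su2Rep ((L : ℝ) ^ 3 * β) u u :=
  div_nonneg (fpBOKernel_nonneg β hΩm hCΩ hΩ0 hW hCW hW0 u u) (transferKernel_pos _ _ _ _).le

/-- ★★ **THE CLAMPED EXACT DIAGONAL RATIO IS PHYSICAL**: for colour-blind bounded measurable `Ω`, the FP weight `fpWeight ε`, any `κ ≥ 0` and any normalisation `c`,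
`W̃ = clampW κ (u ↦ f(u)/c) (min(d_tor,½))` is `IsPhys` (colour: `diagRatio_gaugeTransform`; twist: `diagRatio_twist`). [cite: tHooft1979] -/
theorem isPhys_dressedDiagRatio (β : ℝ) {Ω : LinkSpace L → ℝ} (hΩm : Measurable Ω) {CΩ : ℝ} (hCΩ : ∀ x, |Ω x| ≤ CΩ)
    (hΩinv : ∀ (g : SU2) (x : LinkSpace L), Ω (adL L g x) = Ω x) (ε : ℝ) {κ : ℝ} (hκ : 0 ≤ κ) (c : ℝ) :
    IsPhys (clampW κ (fun u : GaugeConfig 3 1 SU2 => fpBOKernel L β Ω (fpWeight L ε) u u / transferKernel su2Rep ((L : ℝ) ^ 3 * β) u u / c)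
      (fun U : GaugeConfig 3 1 SU2 => min (torDist U) (1 / 2))) := by
  refine isPhys_clampW_capTor hκ ((measurable_diagRatio β hΩm hCΩ (measurable_fpWeight L ε) (abs_fpWeight_le L ε)).div_const c) (fun g u => ?_) (fun k z hz u => ?_)
  · rw [diagRatio_gaugeTransform β hΩm hΩinv (measurable_fpWeight L ε) (fun c g => fpWeight_conj ε c g) g u]
  · rw [diagRatio_twist β Ω (fpWeight L ε) k hz u]

/-! ## §3 ★★ The β-family: the five `W`-fields and the slack on the window -/

/-- ★★ **THE DRESSED-WEIGHT FIELDS FROM A NEAR-`1` FAMILY.**  `f̂ : ℝ → (one-site configs) → ℝ` with every `f̂ β` measurable, gauge and twist invariant; a window radius `δ₁` with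
`δ₁ β ≤ ½` eventually; a slack `ε_W ≥ 0` eventually; and the near-`1` estimate `|f̂ β u − 1| ≤ κ₀·orbitDist u² + ε_W β` on `{orbitDist < δ₁ β}` eventually, where also `0 ≤ f̂ β u`.
Then for every `κ ≥ max κ₀ 0` the weight `W̃ β := clampW κ (f̂ β) (min(d_tor,½))` has: `IsPhys (W̃ β)`, `0 ≤ W̃ β u`, `|W̃ β u| ≤ √(1 + κ/4)`,
`orbitDist u < δ₁ β → |W̃ β u² − 1| ≤ κ·orbitDist u²` (ALL `β`, ALL `u`), and eventually `orbitDist u < δ₁ β → |W̃ β u² − f̂ β u| ≤ ε_W β`. [folklore] -/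
theorem dressedWeight_fields {f : ℝ → GaugeConfig 3 1 SU2 → ℝ} (hfm : ∀ β, Measurable (f β))
    (hfg : ∀ β (g : Site 3 1 → SU2) (u : GaugeConfig 3 1 SU2), f β (gaugeTransform g u) = f β u)
    (hft : ∀ β (k : Fin 3), ∀ z ∈ Subgroup.center SU2, ∀ u : GaugeConfig 3 1 SU2, f β (twist k z u) = f β u)
    {δ₁ εW : ℝ → ℝ} {κ₀ κ : ℝ} (hκκ : κ₀ ≤ κ) (hκ : 0 ≤ κ) (hδ : ∀ᶠ β in atTop, δ₁ β ≤ 1 / 2) (hε : ∀ᶠ β in atTop, 0 ≤ εW β)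
    (hnear : ∀ᶠ β in atTop, ∀ u : GaugeConfig 3 1 SU2, orbitDist u < δ₁ β → 0 ≤ f β u ∧ |f β u - 1| ≤ κ₀ * orbitDist u ^ 2 + εW β) :
    (∀ β, IsPhys (clampW κ (f β) (fun U : GaugeConfig 3 1 SU2 => min (torDist U) (1 / 2)))) ∧
    (∀ β u, 0 ≤ clampW κ (f β) (fun U : GaugeConfig 3 1 SU2 => min (torDist U) (1 / 2)) u) ∧
    (∀ β u, |clampW κ (f β) (fun U : GaugeConfig 3 1 SU2 => min (torDist U) (1 / 2)) u| ≤ Real.sqrt (1 + κ / 4)) ∧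
    (∀ β u, orbitDist u < δ₁ β → |clampW κ (f β) (fun U : GaugeConfig 3 1 SU2 => min (torDist U) (1 / 2)) u ^ 2 - 1| ≤ κ * orbitDist u ^ 2) ∧
    (∀ᶠ β in atTop, ∀ u : GaugeConfig 3 1 SU2, orbitDist u < δ₁ β →
      |clampW κ (f β) (fun U : GaugeConfig 3 1 SU2 => min (torDist U) (1 / 2)) u ^ 2 - f β u| ≤ εW β) := by
  refine ⟨fun β => isPhys_clampW_capTor hκ (hfm β) (hfg β) (hft β), fun β u => clampW_nonneg _ _ _ _, fun β u => abs_clampW_capTor_le hκ (f β) u,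
    fun β u _ => abs_clampW_capTor_sq_sub_one_le hκ (f β) u, ?_⟩
  filter_upwards [hδ, hε, hnear] with β hδβ hεβ hnβ u hu
  obtain ⟨hf0, hf⟩ := hnβ u hu
  exact abs_clampW_capTor_sq_sub_le hκκ hκ hεβ (lt_of_lt_of_le hu hδβ) hf0 hf

end Summit.QuantumFields.YangMills.Theorems.FemtoTransferGap.RateTube

end
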